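import Summits.BirchSwinnertonDyer.BirchSwinnertonDyer.Theorems.CycTangentCMCycTangentBoundAvatarRamified
import Summits.BirchSwinnertonDyer.BirchSwinnertonDyer.Theorems.CycTangentCMCycTangentBoundPowerCharacters
import HarnessLib

set_option linter.dupNamespace false
set_option autoImplicit false

/-!
# Crux `CycTangentCM.CycTangentBound` (stmt-BirchSwinnertonDyer-22628), stub `stub_selfDual`, frame
# uniqueness: THE LINES OF THE UNIQUENESS SUPPLY — coordinates in the `ℤ_p²`-tower, the lines
# `a·κ_𝔭 − κ_𝔭∘θ_c` through the pair, torsion taming, and their non-degeneracy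

Seat `bsd-line-ctcm-p2` (line `tangent-cone-parity`). Plumbing for the uniqueness theorem
`isKatzMeasure₂_unique_of_cm` (next file), which feeds the lead's `isKatzMeasure₂_ext_of_lineSupplies`
(p587325) with supplies on infinitely many pairwise non-proportional `ℤ_p`-lines through the pair:

* §1 `toAdd_eq_coord` — **coordinates**: for a generator pair `(κ₁, κ₂; γ₁, γ₂)` of an imaginary
  quadratic `K`, EVERY continuous `f : Γ_K → ℤ_p` is `f = f(γ₁)·κ₁ + f(γ₂)·κ₂` (it kills the pair
  kernel, p584708; quotient map `Γ_K ↠ ℤ_p²`, density of `ℕ²`).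
* §2 `exists_pow_norm_sub_one_lt` — **torsion taming**: a continuous character `Γ_K → ℚ̄_pˣ` has a
  power with all values in the ball `‖u − 1‖ < ‖p‖` (open subgroups of `ℚ̄_pˣ` swallow a power).
* §3 `exists_line_of_direction` — for a `ℤ_p`-quotient `κ` through the pair with generator `γ`, a
  continuous involution-free datum `θ : Γ_K → Γ_K` (any continuous endomorphism) and `a ∈ pℕ`: the
  map `σ ↦ a·κ(σ) − κ(θσ)` is a `ℤ_p`-quotient `κ_a` THROUGH THE PAIR (unit value `a·κ(θγ) − 1` at
  `θ γ` when `θθ = id`), and every character `χ` through `κ` yields the character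
  `χ^a · (χ ∘ θ)⁻¹` THROUGH `κ_a` (`χ(σ) = (1 + x)^{κ σ}`, `ZpExtension.avatarValueAt_eq_onePlusPow`).
* §4 `det_ne_zero_of_factorsThroughZp` — **non-degeneracy**: if `κ` is unramified at `v̄` and carries
  the avatar `e∘χ` of a Hecke character of type `(k, 0)`, `k ≠ 0`, then the directions of `κ` and
  `κ ∘ θ_c` (`θ_c = absGaloisOuterConj ℚ K c`, `c` a complex conjugation) are NOT proportional:
  otherwise `ker κ` is `θ_c`-stable, `χ` kills `θ_c(I_𝔓)` for `𝔓 ∣ v̄`, i.e. `e∘χ` is unramified at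
  `c̄ • v̄ = v` — contradicting `not_isUnramifiedAt_avatar_of_hasInfinityType_ne_zero` (p590734).

THEOREMS ONLY (no `def`, no fact, no `sorry`); supports, does not close, stmt-BirchSwinnertonDyer-22628.
BSD is not proved by this.

References: [Washington1997] §13.1, Thm. 13.4; [deShalit1987] II.4.17 (51)–(54); [Serre1973] Ch. II §3;
[NeukirchANT1999] Ch. I §9.
-/

noncomputable section

open scoped NumberField Classical Topology
open Filter NumberField IsDedekindDomain Field
open Literature Literature.NumberTheory.GaloisRepresentations Literature.NumberTheory.EllipticCurves
open Summit.BirchSwinnertonDyer.Rank1Residual.X11b.Three.LambdaSupply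

namespace Summit.BirchSwinnertonDyer.BirchSwinnertonDyer.Theorems.CycTangentCMCycTangentBoundUniquenessLines

variable {p : ℕ} [Fact p.Prime] {K : Type} [Field K] [NumberField K]

/-! ### §1. Coordinates of a `ℤ_p`-character in a generator pair -/

/-- **Coordinates.** For `K` imaginary quadratic and a generator pair `(κ₁, κ₂; γ₁, γ₂)`, every
continuous `f : Γ_K →ₜ* ℤ_p` satisfies `f(σ) = f(γ₁)·κ₁(σ) + f(γ₂)·κ₂(σ)`: the difference is a
continuous additive function of the coordinates `(κ₁σ, κ₂σ) ∈ ℤ_p²` (it kills the pair kernel,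
`toAdd_eq_zero_of_isTopGeneratorPair`) vanishing on `ℕ²`, which is dense.
[cite: Washington1997, §13.1 and Thm. 13.4] -/
theorem toAdd_eq_coord (hK : IsImaginaryQuadratic K) {κ₁ κ₂ : ZpExtension K p}
    {γ₁ γ₂ : absoluteGaloisGroup K} (hpair : ZpExtension.IsTopGeneratorPair κ₁ κ₂ γ₁ γ₂)
    (f : absoluteGaloisGroup K →ₜ* Multiplicative ℤ_[p]) (σ : absoluteGaloisGroup K) :
    Multiplicative.toAdd (f σ) = Multiplicative.toAdd (f γ₁) * Multiplicative.toAdd (κ₁ σ) +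
      Multiplicative.toAdd (f γ₂) * Multiplicative.toAdd (κ₂ σ) := by
  have himag : ∀ w : InfinitePlace K, w.IsComplex := fun w ↦ hK.2.isComplex w
  -- the difference `g`
  set g : absoluteGaloisGroup K → ℤ_[p] := fun τ ↦ Multiplicative.toAdd (f τ) -
    (Multiplicative.toAdd (f γ₁) * Multiplicative.toAdd (κ₁ τ) +
      Multiplicative.toAdd (f γ₂) * Multiplicative.toAdd (κ₂ τ)) with hg
  have hgmul : ∀ τ τ', g (τ * τ') = g τ + g τ' := fun τ τ' ↦ by
    simp only [hg, map_mul, toAdd_mul]; ring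
  have hgc : Continuous g :=
    (continuous_toAdd.comp (map_continuous f)).sub
      ((continuous_const.mul (continuous_toAdd.comp (map_continuous κ₁))).add
        (continuous_const.mul (continuous_toAdd.comp (map_continuous κ₂))))
  have e11 : Multiplicative.toAdd (κ₁ γ₁) = 1 := by rw [hpair.left]; rfl
  have e21 : Multiplicative.toAdd (κ₂ γ₁) = 0 := by rw [hpair.apply_left]; rfl
  have e12 : Multiplicative.toAdd (κ₁ γ₂) = 0 := by rw [hpair.apply_right]; rfl
  have e22 : Multiplicative.toAdd (κ₂ γ₂) = 1 := by rw [hpair.right]; rfl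
  have hg1 : g γ₁ = 0 := by simp only [hg, e11, e21]; ring
  have hg2 : g γ₂ = 0 := by simp only [hg, e12, e22]; ring
  have hgker : ∀ τ, κ₁ τ = 1 → κ₂ τ = 1 → g τ = 0 := fun τ h₁ h₂ ↦ by
    have hf : f τ = 1 :=
      CycTangentCMCycTangentBoundPairSupply.toAdd_eq_zero_of_isTopGeneratorPair hK.1 himag hpair f h₁ h₂
    simp only [hg, hf, h₁, h₂, toAdd_one, mul_zero, add_zero, sub_zero]
  -- the quotient map to `ℤ_p²` and the induced continuous function
  set q := fun τ : absoluteGaloisGroup K ↦ (Multiplicative.toAdd (κ₁ τ), Multiplicative.toAdd (κ₂ τ)) with hq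
  have hqc : Continuous q :=
    (continuous_toAdd.comp (map_continuous κ₁)).prodMk (continuous_toAdd.comp (map_continuous κ₂))
  have hqs : Function.Surjective q := surjective_pairMap hpair
  have hfib : ∀ τ τ' : absoluteGaloisGroup K, q τ = q τ' → g τ = g τ' := by
    intro τ τ' hττ'
    simp only [hq, Prod.mk.injEq] at hττ'
    have hk₁ : κ₁ (τ'⁻¹ * τ) = 1 := by
      rw [map_mul, map_inv, ← ofAdd_toAdd (κ₁ τ), ← ofAdd_toAdd (κ₁ τ'), hττ'.1, inv_mul_cancel]
    have hk₂ : κ₂ (τ'⁻¹ * τ) = 1 := by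
      rw [map_mul, map_inv, ← ofAdd_toAdd (κ₂ τ), ← ofAdd_toAdd (κ₂ τ'), hττ'.2, inv_mul_cancel]
    have h1 : g (τ'⁻¹ * τ) = 0 := hgker _ hk₁ hk₂
    have h2 : g (τ'⁻¹ * τ) = g τ'⁻¹ + g τ := hgmul _ _
    have h3 : g τ'⁻¹ + g τ' = 0 := by
      rw [← hgmul, inv_mul_cancel]
      have := hgmul 1 1
      rw [mul_one] at this
      linear_combination -this
    linear_combination (h2.symm.trans h1) - h3
  set gbar : ℤ_[p] × ℤ_[p] → ℤ_[p] := fun c ↦ g (Function.surjInv hqs c) with hgbar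
  have hgq : ∀ τ, gbar (q τ) = g τ := fun τ ↦ hfib _ _ (Function.surjInv_eq hqs (q τ))
  have hquot : Topology.IsQuotientMap q := hqc.isClosedMap.isQuotientMap hqc hqs
  have hgbc : Continuous gbar := by
    rw [hquot.continuous_iff, show gbar ∘ q = g from funext fun τ ↦ hgq τ]
    exact hgc
  -- `gbar` vanishes on `ℕ²`, hence everywhere
  have hnat : ∀ n m : ℕ, q (γ₁ ^ n * γ₂ ^ m) = ((n : ℤ_[p]), (m : ℤ_[p])) := by
    intro n m
    simp only [hq, map_mul, map_pow, toAdd_mul, toAdd_pow, e11, e21, e12, e22, nsmul_eq_mul, mul_one,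
      mul_zero, add_zero, zero_add]
  have hgpow : ∀ (τ : absoluteGaloisGroup K) (n : ℕ), g (τ ^ n) = n * g τ := by
    intro τ n
    induction n with
    | zero =>
      simp only [pow_zero, Nat.cast_zero, zero_mul]
      have := hgmul 1 1
      rw [mul_one] at this
      linear_combination -this
    | succ n ih => rw [pow_succ, hgmul, ih]; push_cast; ring
  have hnat0 : ∀ n m : ℕ, gbar ((n : ℤ_[p]), (m : ℤ_[p])) = 0 := by
    intro n m
    rw [← hnat n m, hgq, hgmul, hgpow, hgpow, hg1, hg2, mul_zero, mul_zero, add_zero]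
  have hclosed : IsClosed {c : ℤ_[p] × ℤ_[p] | gbar c = 0} := isClosed_eq hgbc continuous_const
  have hall : ∀ c : ℤ_[p] × ℤ_[p], gbar c = 0 := by
    have step : ∀ (m : ℕ) (a : ℤ_[p]), gbar (a, (m : ℤ_[p])) = 0 := fun m a ↦
      PadicInt.denseRange_natCast.induction_on (p := fun a : ℤ_[p] ↦ gbar (a, (m : ℤ_[p])) = 0) a
        (hclosed.preimage (continuous_id.prodMk continuous_const)) (fun n ↦ hnat0 n m)
    rintro ⟨a, b⟩
    exact PadicInt.denseRange_natCast.induction_on (p := fun b : ℤ_[p] ↦ gbar (a, b) = 0) b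
      (hclosed.preimage (continuous_const.prodMk continuous_id)) (fun m ↦ step m a)
  have hgσ : g σ = 0 := by rw [← hgq]; exact hall _
  simp only [hg] at hgσ
  linear_combination hgσ

/-! ### §2. Torsion taming: a power of a character takes values near `1` -/

/-- **A continuous character `χ : Γ_K → ℚ̄_pˣ` has a power `χ^N`, `N ≥ 1`, with
`‖χ(σ)^N − 1‖ < ‖p‖` for all `σ`** (read in `ℂ_p` through `avatarValueAt`): the congruence ball
`{u : ‖1 − u‖ ≤ ‖p‖²}` is an open subgroup of `ℚ̄_pˣ` and swallows a power of the compact image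
(`PadicUnits.exists_pow_mem_of_isOpen`). Such values have no `p`-power torsion
(`avatarValueAt_torsionFree_of_norm_sub_one_lt`). [cite: Serre1973, Ch. II §3.1] -/
theorem exists_pow_norm_sub_one_lt (χ : absoluteGaloisGroup K →ₜ* (PadicAlgCl p)ˣ) :
    ∃ N : ℕ, 0 < N ∧ ∀ σ : absoluteGaloisGroup K,
      ‖avatarValueAt ((FramedRep.unitsContinuousMulEquivOfUnique (Fin 1) (PadicAlgCl p) :
          (PadicAlgCl p)ˣ →ₜ* GL (Fin 1) (PadicAlgCl p)).comp (χ ^ N)) σ - 1‖ < ‖(p : ℂ_[p])‖ := by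
  have hp : p.Prime := Fact.out
  have hpn : ‖(p : PadicAlgCl p)‖ < 1 := by
    rw [← map_natCast (algebraMap ℚ_[p] (PadicAlgCl p)), show (algebraMap ℚ_[p] (PadicAlgCl p)) (p : ℚ_[p])
      = ((p : ℚ_[p]) : PadicAlgCl p) from rfl, PadicAlgCl.norm_extends, Padic.norm_p]
    exact inv_lt_one_of_one_lt₀ (by exact_mod_cast hp.one_lt)
  have hp0 : 0 < ‖(p : PadicAlgCl p)‖ := norm_pos_iff.mpr (by exact_mod_cast hp.ne_zero)
  set ρ : ℝ := ‖(p : PadicAlgCl p)‖ ^ 2 with hρ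
  have hρ1 : ρ < 1 := by rw [hρ]; nlinarith
  have hρp : ρ < ‖(p : PadicAlgCl p)‖ := by rw [hρ]; nlinarith
  obtain ⟨B, hB⟩ := PadicUnits.exists_ballUnits (F := PadicAlgCl p) (sq_nonneg _ : (0 : ℝ) ≤ ρ) hρ1
  have hBopen : IsOpen (B : Set (PadicAlgCl p)ˣ) := by
    have : (B : Set (PadicAlgCl p)ˣ) = {u | ‖1 - ((u : (PadicAlgCl p)ˣ) : PadicAlgCl p)‖ ≤ ρ} :=
      Set.ext fun u ↦ hB u
    rw [this]
    exact PadicUnits.isOpen_setOf_norm_one_sub_le (ne_of_gt (by rw [hρ]; exact pow_pos hp0 2))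
  obtain ⟨N, hN, hmem⟩ := PadicUnits.exists_pow_mem_of_isOpen χ.toMonoidHom χ.continuous B hBopen
  refine ⟨N, hN, fun σ ↦ ?_⟩
  have h1 : ‖1 - (((χ σ) ^ N : (PadicAlgCl p)ˣ) : PadicAlgCl p)‖ ≤ ρ := (hB _).mp (hmem σ)
  rw [avatarValueAt_unitsChar, ContinuousMonoidHom.pow_apply, ← norm_neg, neg_sub,
    show (1 : ℂ_[p]) - ((((χ σ ^ N : (PadicAlgCl p)ˣ) : PadicAlgCl p)) : ℂ_[p]) =
      (((1 - ((χ σ ^ N : (PadicAlgCl p)ˣ) : PadicAlgCl p) : PadicAlgCl p)) : ℂ_[p]) by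
        rw [UniformSpace.Completion.coe_sub, UniformSpace.Completion.coe_one],
    PadicComplex.norm_extends, ← PadicComplex.coe_natCast, PadicComplex.norm_extends]
  exact h1.trans_lt hρp

/-! ### §3. The line of direction `a·κ − κ∘θ` through the pair and its characters -/

/-- **The line `a·κ − κ∘θ`.** Let `(κ₁, κ₂; γ₁, γ₂)` be a generator pair of the imaginary quadratic
`K`, `κ` a `ℤ_p`-quotient through the pair with topological generator `γ`, `θ : Γ_K →ₜ* Γ_K` with
`θ (θ σ) = σ`, and `a = p·a'`. Then `L(σ) = a·κ(σ) − κ(θσ)` is a `ℤ_p`-QUOTIENT `κ_a` through the pair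
(its value at `θ γ` is the unit `a·κ(θγ) − 1`), with a topological generator, and for every
continuous character `χ : Γ_K → ℚ̄_pˣ` through `κ` the character `χ^a · (χ ∘ θ)⁻¹` is through `κ_a`
(`χ(τ) = (1 + x)^{κ(τ)}` along `κ`, `ZpExtension.avatarValueAt_eq_onePlusPow`; on `ker κ_a`,
`κ(σ^a) = a·κ(σ) = κ(θσ)`). [cite: Washington1997, §13.1] [cite: deShalit1987, II.4.17 (52)–(54) (p. 77–78)] -/
theorem exists_line_of_direction (hK : IsImaginaryQuadratic K) {κ₁ κ₂ : ZpExtension K p}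
    {γ₁ γ₂ : absoluteGaloisGroup K} (hpair : ZpExtension.IsTopGeneratorPair κ₁ κ₂ γ₁ γ₂)
    {κ : ZpExtension K p} (hκ : ZpExtension.pairKer κ₁ κ₂ ≤ κ.kerSubgroup)
    {γ : absoluteGaloisGroup K} (hγ : κ.IsTopGenerator γ)
    (θ : absoluteGaloisGroup K →ₜ* absoluteGaloisGroup K) (hθθ : ∀ σ, θ (θ σ) = σ) (a' : ℕ) :
    ∃ (κa : ZpExtension K p) (γa : absoluteGaloisGroup K),
      ZpExtension.pairKer κ₁ κ₂ ≤ κa.kerSubgroup ∧ κa.IsTopGenerator γa ∧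
      (∀ σ, Multiplicative.toAdd (κa σ) =
        ((p * a' : ℕ) : ℤ_[p]) * Multiplicative.toAdd (κ σ) - Multiplicative.toAdd (κ (θ σ))) ∧
      ∀ χ : absoluteGaloisGroup K →ₜ* (PadicAlgCl p)ˣ, (∀ σ, κ σ = 1 → χ σ = 1) →
        ∀ σ, κa σ = 1 → (χ ^ (p * a') * (χ.comp θ)⁻¹) σ = 1 := by
  have himag : ∀ w : InfinitePlace K, w.IsComplex := fun w ↦ hK.2.isComplex w
  set a : ℕ := p * a' with ha
  -- the hom `L`
  let L : absoluteGaloisGroup K →ₜ* Multiplicative ℤ_[p] :=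
    { toFun := fun σ ↦ Multiplicative.ofAdd
        ((a : ℤ_[p]) * Multiplicative.toAdd (κ σ) - Multiplicative.toAdd (κ (θ σ)))
      map_one' := by simp
      map_mul' := fun σ τ ↦ by
        rw [← ofAdd_add]
        congr 1
        simp only [map_mul, toAdd_mul]
        ring
      continuous_toFun :=
        continuous_ofAdd.comp ((continuous_const.mul (continuous_toAdd.comp (map_continuous κ))).sub
          (continuous_toAdd.comp ((map_continuous κ).comp (map_continuous θ)))) }
  have hL : ∀ σ, Multiplicative.toAdd (L σ) =
      (a : ℤ_[p]) * Multiplicative.toAdd (κ σ) - Multiplicative.toAdd (κ (θ σ)) := fun σ ↦ rfl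
  -- unit value at `θ γ`
  have hγ1 : Multiplicative.toAdd (κ γ) = 1 := by rw [show κ γ = Multiplicative.ofAdd 1 from hγ]; rfl
  have hunit : IsUnit (Multiplicative.toAdd (L (θ γ))) := by
    rw [hL, hθθ, hγ1]
    have hlt : ‖(a : ℤ_[p]) * Multiplicative.toAdd (κ (θ γ))‖ < 1 := by
      rw [ha, Nat.cast_mul, mul_assoc, norm_mul, PadicInt.norm_p]
      have h1 : ‖((a' : ℤ_[p]) * Multiplicative.toAdd (κ (θ γ)))‖ ≤ 1 := PadicInt.norm_le_one _
      have hp1 : (p : ℝ)⁻¹ < 1 := inv_lt_one_of_one_lt₀ (by exact_mod_cast (Fact.out : p.Prime).one_lt)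
      have hp0 : 0 < (p : ℝ)⁻¹ := inv_pos.mpr (by exact_mod_cast (Fact.out : p.Prime).pos)
      nlinarith [norm_nonneg ((a' : ℤ_[p]) * Multiplicative.toAdd (κ (θ γ)))]
    apply PadicInt.isUnit_iff.mpr
    have : (a : ℤ_[p]) * Multiplicative.toAdd (κ (θ γ)) - 1 =
        -(1 + -((a : ℤ_[p]) * Multiplicative.toAdd (κ (θ γ)))) := by ring
    rw [this, norm_neg, PadicInt.norm_add_eq_max_of_ne (by rw [norm_one, norm_neg]; exact hlt.ne'),
      norm_one, norm_neg]
    exact max_eq_left hlt.le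
  let κa : ZpExtension K p := ⟨L, ZpExtension.surjective_of_isUnit_toAdd L hunit⟩
  refine ⟨κa, κa.lift 1, fun σ hσ ↦ ?_, κa.apply_lift 1, fun σ ↦ hL σ, fun χ hχ σ hσ ↦ ?_⟩
  · -- through the pair
    obtain ⟨h₁, h₂⟩ := ZpExtension.mem_pairKer_iff.mp hσ
    have hκσ : κ σ = 1 := ZpExtension.mem_kerSubgroup.mp (hκ hσ)
    have hθσ : κ (θ σ) = 1 := by
      have h₁' : κ₁ (θ σ) = 1 := by
        have := CycTangentCMCycTangentBoundPairSupply.toAdd_eq_zero_of_isTopGeneratorPair hK.1 himag hpair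
          (κ₁.toContinuousMonoidHom.comp θ) (ZpExtension.mem_kerSubgroup.mp h₁) (ZpExtension.mem_kerSubgroup.mp h₂)
        rwa [ContinuousMonoidHom.coe_comp, Function.comp_apply, ZpExtension.coe_toContinuousMonoidHom] at this
      have h₂' : κ₂ (θ σ) = 1 := by
        have := CycTangentCMCycTangentBoundPairSupply.toAdd_eq_zero_of_isTopGeneratorPair hK.1 himag hpair
          (κ₂.toContinuousMonoidHom.comp θ) (ZpExtension.mem_kerSubgroup.mp h₁) (ZpExtension.mem_kerSubgroup.mp h₂)
        rwa [ContinuousMonoidHom.coe_comp, Function.comp_apply, ZpExtension.coe_toContinuousMonoidHom] at this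
      exact ZpExtension.mem_kerSubgroup.mp (hκ (ZpExtension.mem_pairKer_iff.mpr
        ⟨ZpExtension.mem_kerSubgroup.mpr h₁', ZpExtension.mem_kerSubgroup.mpr h₂'⟩))
    rw [ZpExtension.mem_kerSubgroup]
    change L σ = 1
    rw [← ofAdd_toAdd (L σ), hL, hκσ, hθσ, toAdd_one, mul_zero, sub_zero, ofAdd_zero]
  · -- the character `χ^a (χ∘θ)⁻¹` kills `ker κa`
    have hσ' : (a : ℤ_[p]) * Multiplicative.toAdd (κ σ) = Multiplicative.toAdd (κ (θ σ)) := by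
      have h := hσ
      change L σ = 1 at h
      rw [← ofAdd_toAdd (L σ), hL, ← ofAdd_zero] at h
      exact sub_eq_zero.mp (Multiplicative.ofAdd.injective h)
    -- through `κ`, in the `GL₁` currency
    set r := (FramedRep.unitsContinuousMulEquivOfUnique (Fin 1) (PadicAlgCl p) :
      (PadicAlgCl p)ˣ →ₜ* GL (Fin 1) (PadicAlgCl p)).comp χ with hr
    have hrκ : FactorsThroughZp κ r := (factorsThroughZp_unitsChar_iff κ χ).mpr hχ
    have hval : avatarValueAt r (σ ^ a) = avatarValueAt r (θ σ) := by
      rw [ZpExtension.avatarValueAt_eq_onePlusPow hrκ hγ (σ ^ a),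
        ZpExtension.avatarValueAt_eq_onePlusPow hrκ hγ (θ σ), map_pow, toAdd_pow, nsmul_eq_mul, hσ']
    have h2 : χ (σ ^ a) = χ (θ σ) := by
      rw [hr, avatarValueAt_unitsChar, avatarValueAt_unitsChar] at hval
      exact Units.ext (UniformSpace.Completion.coe_injective (PadicAlgCl p) hval)
    rw [ContinuousMonoidHom.mul_apply, ContinuousMonoidHom.pow_apply, unitsChar_inv_apply,
      ContinuousMonoidHom.coe_comp, Function.comp_apply, ← map_pow, h2, mul_inv_cancel]

/-! ### §4. Non-degeneracy of the directions `κ` and `κ ∘ θ_c` -/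

/-- **`ker κ` is not stable under the outer action of complex conjugation** — in coordinates: the
directions `(κ γ₁, κ γ₂)` and `(κ(θ_c γ₁), κ(θ_c γ₂))` are NOT proportional — whenever `κ` is a
`ℤ_p`-quotient through the pair, unramified at `v̄`, carrying the avatar `e∘χ` of a Hecke character of
infinity type `(k, 0)`, `k ≠ 0`, unramified everywhere. Otherwise `ker κ ∋ I_𝔓` (`𝔓 ∣ v̄`) would be
`θ_c`-stable (coordinates, §1), `e∘χ∘θ_c` unramified at `v̄`, i.e. `e∘χ` unramified at
`c̄ • v̄ = v` (`FramedGaloisRep.isUnramifiedAt_outerConj_iff`), contradicting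
`not_isUnramifiedAt_avatar_of_hasInfinityType_ne_zero`.
[cite: SerreAbelianLadic1968, Ch. III §2.3] [cite: NeukirchANT1999, Ch. I §9 Prop. (9.1)] -/
theorem toAdd_mul_ne_of_isPAdicAvatarOf [IsGalois ℚ K] (ι : PadicAlgCl p ≃+* ℂ)
    (hK : IsImaginaryQuadratic K) {v vbar : HeightOneSpectrum (𝓞 K)}
    (hv : ((p : ℕ) : 𝓞 K) ∈ v.asIdeal) (hvbar : ((p : ℕ) : 𝓞 K) ∈ vbar.asIdeal) (hne : vbar ≠ v)
    (hι : ∀ (w : InfinitePlace K) (d : 𝓞 K), d ∈ v.asIdeal ↔ ‖ι.symm (w.embedding (d : K))‖ < 1)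
    {κ₁ κ₂ : ZpExtension K p} {γ₁ γ₂ : absoluteGaloisGroup K}
    (hpair : ZpExtension.IsTopGeneratorPair κ₁ κ₂ γ₁ γ₂)
    {κ : ZpExtension K p}
    (hκv : ∀ 𝔓 ∈ vbar.primesAbove, 𝔓.inertia (absoluteGaloisGroup K) ≤ κ.kerSubgroup)
    {φ : HeckeCharacter K} {k : ℤ} (hk : k ≠ 0) (hinf : φ.HasInfinityType (fun _ ↦ k) (fun _ ↦ 0))
    (hφu : ∀ w : HeightOneSpectrum (𝓞 K), φ.IsUnramifiedAt w)
    {χ : absoluteGaloisGroup K →ₜ* (PadicAlgCl p)ˣ}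
    (hav : IsPAdicAvatarOf ι φ ((FramedRep.unitsContinuousMulEquivOfUnique (Fin 1) (PadicAlgCl p) :
      (PadicAlgCl p)ˣ →ₜ* GL (Fin 1) (PadicAlgCl p)).comp χ))
    (hχκ : ∀ σ, κ σ = 1 → χ σ = 1)
    {c : absoluteGaloisGroup ℚ} (hc : c ∉ Set.range (absGaloisRestrict ℚ K)) :
    Multiplicative.toAdd (κ γ₁) * Multiplicative.toAdd (κ (absGaloisOuterConj ℚ K c γ₂)) ≠
      Multiplicative.toAdd (κ γ₂) * Multiplicative.toAdd (κ (absGaloisOuterConj ℚ K c γ₁)) := by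
  set θ := absGaloisOuterConj ℚ K c with hθ
  intro heq
  -- coordinates of `κ` and `κ ∘ θ`
  set d₁ := Multiplicative.toAdd (κ γ₁) with hd₁
  set d₂ := Multiplicative.toAdd (κ γ₂) with hd₂
  set d₁' := Multiplicative.toAdd (κ (θ γ₁)) with hd₁'
  set d₂' := Multiplicative.toAdd (κ (θ γ₂)) with hd₂'
  have hcoord : ∀ σ, Multiplicative.toAdd (κ σ) =
      d₁ * Multiplicative.toAdd (κ₁ σ) + d₂ * Multiplicative.toAdd (κ₂ σ) :=
    fun σ ↦ toAdd_eq_coord hK hpair κ.toContinuousMonoidHom σ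
  have hcoord' : ∀ σ, Multiplicative.toAdd (κ (θ σ)) =
      d₁' * Multiplicative.toAdd (κ₁ σ) + d₂' * Multiplicative.toAdd (κ₂ σ) :=
    fun σ ↦ toAdd_eq_coord hK hpair (κ.toContinuousMonoidHom.comp θ) σ
  -- `(d₁, d₂) ≠ 0`
  have hd : d₁ ≠ 0 ∨ d₂ ≠ 0 := by
    by_contra h
    push Not at h
    have h1 := hcoord (κ.lift 1)
    rw [ZpExtension.apply_lift, toAdd_ofAdd, h.1, h.2, zero_mul, zero_mul, add_zero] at h1
    exact one_ne_zero h1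
  -- `ker κ` is `θ`-stable
  have hstable : ∀ σ, κ σ = 1 → κ (θ σ) = 1 := by
    intro σ hσ
    have h0 : d₁ * Multiplicative.toAdd (κ₁ σ) + d₂ * Multiplicative.toAdd (κ₂ σ) = 0 := by
      rw [← hcoord, hσ, toAdd_one]
    set E := d₁' * Multiplicative.toAdd (κ₁ σ) + d₂' * Multiplicative.toAdd (κ₂ σ) with hE
    have hE1 : d₁ * E = 0 := by
      have : d₁ * E = d₁' * (d₁ * Multiplicative.toAdd (κ₁ σ) + d₂ * Multiplicative.toAdd (κ₂ σ)) := by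
        rw [hE]; linear_combination Multiplicative.toAdd (κ₂ σ) * heq
      rw [this, h0, mul_zero]
    have hE2 : d₂ * E = 0 := by
      have : d₂ * E = d₂' * (d₁ * Multiplicative.toAdd (κ₁ σ) + d₂ * Multiplicative.toAdd (κ₂ σ)) := by
        rw [hE]; linear_combination (-Multiplicative.toAdd (κ₁ σ)) * heq
      rw [this, h0, mul_zero]
    have hE0 : E = 0 := by
      rcases hd with h | h
      · exact (mul_eq_zero.mp hE1).resolve_left h
      · exact (mul_eq_zero.mp hE2).resolve_left h
    rw [← ofAdd_toAdd (κ (θ σ)), hcoord', ← hE, hE0, ofAdd_zero]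
  -- `e∘χ∘θ` is unramified at `v̄`
  set r : FramedGaloisRep K (PadicAlgCl p) 1 :=
    (FramedRep.unitsContinuousMulEquivOfUnique (Fin 1) (PadicAlgCl p) :
      (PadicAlgCl p)ˣ →ₜ* GL (Fin 1) (PadicAlgCl p)).comp χ with hr
  have hunrθ : (FramedGaloisRep.outerConj c r).IsUnramifiedAt vbar := by
    intro 𝔓 h𝔓 τ hτ
    have hκτ : κ τ = 1 := ZpExtension.mem_kerSubgroup.mp (hκv 𝔓 h𝔓 hτ)
    have hχ : χ (θ τ) = 1 := hχκ _ (hstable τ hκτ)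
    rw [FramedGaloisRep.outerConj_apply, ← hθ, hr, ContinuousMonoidHom.coe_comp, Function.comp_apply, hχ,
      map_one]
  -- hence `e∘χ` is unramified at `c̄ • v̄ = v`
  have hcbar : absGaloisQuot ℚ K c ≠ 1 := fun h1 ↦ by
    obtain ⟨x, hx⟩ := (absGaloisQuot_eq_one_iff ℚ K c).1 h1
    exact hc ⟨x, hx⟩
  have hunrv : r.IsUnramifiedAt v := by
    have h := (FramedGaloisRep.isUnramifiedAt_outerConj_iff c r vbar).mp hunrθ
    rwa [CycTangentCMCycTangentBoundAvatarRamified.smul_eq_of_ne_one hK.1 hv hvbar hne hcbar] at h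
  exact CycTangentCMCycTangentBoundAvatarRamified.not_isUnramifiedAt_avatar_of_hasInfinityType_ne_zero ι hK
    hv hvbar hne hι hk hinf (T := ∅) (fun w _ ↦ hφu w) (hφu v) hav hunrv

end Summit.BirchSwinnertonDyer.BirchSwinnertonDyer.Theorems.CycTangentCMCycTangentBoundUniquenessLines

end
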